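import Mathlib
import HarnessLib
import Summits.Ventures.LatticeQCDFlow.Scoring.SplitChainGaps

/-!
# Tours of the split chain, I: pathwise bookkeeping — head counts, tour-start times, and the
# transport of tour functionals to the tour start; integrability of series of functions

HONEST FRAMING: exact (Metropolis-corrected) sampling algorithms for lattice gauge theory;
figures of merit are autocorrelation/cost numbers at stated couplings and volumes; no
continuum-physics claim.

Venture `LatticeQCDFlow` (cell pub-lqcd), topic `Scoring`; FANOUT row 8 (`s0-cpn-nemc`, GEN-16).
NEW WORK of the cell, not a published result; no definition is introduced.  With the head count
`K_t := #{1 ≤ s ≤ t : coin_s = heads}` of a coin-tagged path (written inline as a `Finset` sum),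
TOUR `i` is the set of times `{t : K_t = i}`: tour `0` runs from time `0` to the first head
(exclusive), tour `j + 1` starts AT the `(j+1)`-th head time `τ_{j+1}`, and
`{τ_{j+1} = t + 1} = {K_t = j} ∩ {coin_{t+1} = heads}`.  A TOUR FUNCTIONAL is an additive functional
`S^ψ_i(x̂) := ∑' u, 1{K_u = i} · ψ(x̂_u, x̂_{u+1})` — tour length (`ψ = 1`), the tour sum of an
observable (`ψ(p, q) = f(p.1)`), "the tour ends" (`ψ(p, q) = 1{q.2}`).  This file is the pathwise
half of the tour decomposition: `K_{t+1+n} = K_t + 1{coin_{t+1}} + K_n ∘ θ_{t+1}`; the tour starts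
telescope, `Σ_{t<n} 1{K_t = j} 1{coin_{t+1}} = 1{K_n ≥ j + 1}` (so each occurs at most once); and the
TRANSPORT identity `Λ(S^{ψ₁}_{j+1}, S^{ψ₂}_{j+1}) = ∑' t, 1{K_t = j} 1{coin_{t+1}} ·
Λ(S^{ψ₁}_0, S^{ψ₂}_0) ∘ θ_{t+1}` for every `Λ` with `Λ(0, 0) = 0` — a functional of tour `j + 1` is the
same functional of tour `0` of the path restarted at `τ_{j+1}`.  Plus measure-theoretic bookkeeping
used by the tour theorem (`Scoring/SplitChainTourTheorem.lean`).  Printed counterpart NAMED ONLY: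
the regenerative (tour) decomposition of a split chain (Athreya–Ney 1978; Nummelin 1978;
Meyn–Tweedie 1993 §17.3.1; Mykland–Tierney–Yu 1995 §2) — nothing is cited as a fact.

## Content (`K_t x̂ = ∑_{s<t} (if (x̂ (s+1)).2 then 1 else 0)`; `θ_s x̂ = (n ↦ x̂ (s + n))`)

* `headCount_succ`, `headCount_add`, `headCount_mono`, `headCount_eq_zero_indicator` (`1{K_t = 0}` is
  the tails product of `Scoring/SplitChainGaps.lean`), **`sum_tourStart_indicator`**,
  `tourStart_unique`, **`tourSum_transport`**, **`tourSum_eq_tsum_tourStart`**, `tourStart_tsum_mem`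
  — pathwise, for every path;
* `integrable_tsum_of_summable_integral_norm` — a series of integrable real functions with summable
  `L¹` norms is integrable (companion of Mathlib's `integral_tsum_of_summable_integral_norm`);
* `measurable_headCount`, `measurable_headCountIndicator`, `measurable_tourSum`;
* `summable_integral_tourStart` — `Σ_{t<n} E[|G_t| 1{K_t = j} 1{coin_{t+1}}] ≤ C` for `|G_t| ≤ C` (any law on
  paths of a Markov kernel on `Ω × Bool`), hence the series is summable.

NOT CLAIMED: anything probabilistic — that is `Scoring/SplitChainTourTheorem.lean`.
-/

noncomputable section

namespace Summit.Ventures.LatticeQCDFlow.Scoring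

open MeasureTheory ProbabilityTheory Filter Finset Preorder Literature.Probability.MarkovChains
open scoped ENNReal

/-! ### Pathwise bookkeeping: head counts, tour starts, transport -/

section HeadCount

variable {Ω : Type*}

/-- `K_{t+1} = K_t + 1{coin_{t+1}}`. -/
theorem headCount_succ (x : ℕ → Ω × Bool) (t : ℕ) :
    (∑ s ∈ Finset.range (t + 1), (if (x (s + 1)).2 then (1 : ℕ) else 0))
      = (∑ s ∈ Finset.range t, (if (x (s + 1)).2 then (1 : ℕ) else 0))
        + (if (x (t + 1)).2 then 1 else 0) :=
  Finset.sum_range_succ _ _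

/-- `K_{t+1+n}(x̂) = K_t(x̂) + 1{coin_{t+1}} + K_n(θ_{t+1} x̂)`. -/
theorem headCount_add (x : ℕ → Ω × Bool) (t n : ℕ) :
    (∑ s ∈ Finset.range (t + 1 + n), (if (x (s + 1)).2 then (1 : ℕ) else 0))
      = (∑ s ∈ Finset.range t, (if (x (s + 1)).2 then (1 : ℕ) else 0))
        + (if (x (t + 1)).2 then 1 else 0)
        + ∑ s ∈ Finset.range n, (if (x (t + 1 + s + 1)).2 then (1 : ℕ) else 0) := by
  rw [Finset.sum_range_add, Finset.sum_range_succ]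

/-- `K` is nondecreasing in time. -/
theorem headCount_mono (x : ℕ → Ω × Bool) {u t : ℕ} (h : u ≤ t) :
    (∑ s ∈ Finset.range u, (if (x (s + 1)).2 then (1 : ℕ) else 0))
      ≤ ∑ s ∈ Finset.range t, (if (x (s + 1)).2 then (1 : ℕ) else 0) :=
  Finset.sum_le_sum_of_subset (Finset.range_subset_range.2 h)

/-- `1{K_t = 0}` is the tails product `∏_{i<t} 1{coin_{i+1} = tails}`. -/
theorem headCount_eq_zero_indicator (x : ℕ → Ω × Bool) (t : ℕ) :
    (if (∑ s ∈ Finset.range t, (if (x (s + 1)).2 then (1 : ℕ) else 0)) = 0 then (1 : ℝ) else 0)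
      = ∏ i ∈ Finset.range t, (if (x (i + 1)).2 then (0 : ℝ) else 1) := by
  by_cases h : ∀ i ∈ Finset.range t, (x (i + 1)).2 = false
  · rw [if_pos (Finset.sum_eq_zero fun i hi => by simp [h i hi])]
    exact (Finset.prod_eq_one fun i hi => by simp [h i hi]).symm
  · push Not at h
    obtain ⟨i, hi, hx⟩ := h
    simp only [Bool.not_eq_false] at hx
    rw [Finset.prod_eq_zero hi (by simp [hx]), if_neg]
    intro hs
    have := (Finset.sum_eq_zero_iff.1 hs) i hi
    simp [hx] at this

/-- **Tour starts telescope**: `Σ_{t<n} 1{K_t = j} · 1{coin_{t+1}} = 1{j + 1 ≤ K_n}` — the `(j+1)`-th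
head occurs at most once, and it has occurred by time `n` iff `K_n ≥ j + 1`. -/
theorem sum_tourStart_indicator (x : ℕ → Ω × Bool) (j : ℕ) : ∀ n : ℕ,
    ∑ t ∈ Finset.range n,
        (if (∑ s ∈ Finset.range t, (if (x (s + 1)).2 then (1 : ℕ) else 0)) = j then (1 : ℝ) else 0)
          * (if (x (t + 1)).2 then (1 : ℝ) else 0)
      = if j + 1 ≤ ∑ s ∈ Finset.range n, (if (x (s + 1)).2 then (1 : ℕ) else 0) then (1 : ℝ) else 0
  | 0 => by simp
  | n + 1 => by
    rw [Finset.sum_range_succ, sum_tourStart_indicator x j n, headCount_succ]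
    set K := ∑ s ∈ Finset.range n, (if (x (s + 1)).2 then (1 : ℕ) else 0) with hK
    by_cases hc : (x (n + 1)).2 = true
    · simp only [hc, if_true, mul_one]
      by_cases h1 : j + 1 ≤ K
      · rw [if_pos h1, if_neg (by omega), if_pos (by omega)]; ring
      · rw [if_neg h1]
        by_cases h2 : K = j
        · rw [if_pos h2, if_pos (by omega)]; ring
        · rw [if_neg h2, if_neg (by omega)]; ring
    · simp only [hc, if_false, mul_zero, add_zero, Bool.false_eq_true]

/-- **At most one tour start per index**: if `K_t = j`, `coin_{t+1}` heads and `K_{t'} = j`,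
`coin_{t'+1}` heads, then `t = t'`. -/
theorem tourStart_unique (x : ℕ → Ω × Bool) {j t t' : ℕ}
    (ht : (∑ s ∈ Finset.range t, (if (x (s + 1)).2 then (1 : ℕ) else 0)) = j)
    (hh : (x (t + 1)).2 = true)
    (ht' : (∑ s ∈ Finset.range t', (if (x (s + 1)).2 then (1 : ℕ) else 0)) = j)
    (hh' : (x (t' + 1)).2 = true) : t = t' := by
  by_contra hne
  rcases Nat.lt_or_gt_of_ne hne with hlt | hlt
  · obtain ⟨m, rfl⟩ := Nat.exists_eq_add_of_lt hlt
    rw [show t + m + 1 = t + 1 + m by omega, headCount_add, ht, hh] at ht'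
    simp only [if_true] at ht'
    omega
  · obtain ⟨m, rfl⟩ := Nat.exists_eq_add_of_lt hlt
    rw [show t' + m + 1 = t' + 1 + m by omega, headCount_add, ht', hh'] at ht
    simp only [if_true] at ht
    omega

/-- **TRANSPORT OF TOUR FUNCTIONALS**: if `K_t = j` and `coin_{t+1}` heads (the `(j+1)`-th tour
starts at `t + 1`), then `S^ψ_{j+1}(x̂) = S^ψ_0(θ_{t+1} x̂)` for every `ψ`. -/
theorem tourSum_transport (ψ : Ω × Bool → Ω × Bool → ℝ) (x : ℕ → Ω × Bool) {j t : ℕ}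
    (ht : (∑ s ∈ Finset.range t, (if (x (s + 1)).2 then (1 : ℕ) else 0)) = j)
    (hh : (x (t + 1)).2 = true) :
    ∑' u, (if (∑ s ∈ Finset.range u, (if (x (s + 1)).2 then (1 : ℕ) else 0)) = j + 1
        then (1 : ℝ) else 0) * ψ (x u) (x (u + 1))
      = ∑' n, (if (∑ s ∈ Finset.range n, (if (x (t + 1 + (s + 1))).2 then (1 : ℕ) else 0)) = 0
        then (1 : ℝ) else 0) * ψ (x (t + 1 + n)) (x (t + 1 + (n + 1))) := by
  symm
  have hinj : Function.Injective (fun n : ℕ => t + 1 + n) := fun a b h => by simpa using h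
  rw [← hinj.tsum_eq (f := fun u => (if (∑ s ∈ Finset.range u,
      (if (x (s + 1)).2 then (1 : ℕ) else 0)) = j + 1 then (1 : ℝ) else 0) * ψ (x u) (x (u + 1)))]
  · refine tsum_congr fun n => ?_
    have hK : (∑ s ∈ Finset.range (t + 1 + n), (if (x (s + 1)).2 then (1 : ℕ) else 0))
        = j + 1 + ∑ s ∈ Finset.range n, (if (x (t + 1 + (s + 1))).2 then (1 : ℕ) else 0) := by
      rw [headCount_add, ht, hh]; rfl
    simp only [hK, Nat.add_eq_left]
    rfl
  · intro u hu
    rw [Function.mem_support] at hu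
    have hK : (∑ s ∈ Finset.range u, (if (x (s + 1)).2 then (1 : ℕ) else 0)) = j + 1 := by
      by_contra h; exact hu (by rw [if_neg h, zero_mul])
    have htu : t + 1 ≤ u := by
      by_contra h
      have := headCount_mono x (show u ≤ t by omega)
      omega
    exact ⟨u - (t + 1), by show t + 1 + (u - (t + 1)) = u; omega⟩

/-- **TOUR FUNCTIONALS AS A SUM OVER THE TOUR START**: for every `Λ` with `Λ 0 0 = 0`,
`Λ(S^{ψ₁}_{j+1} x̂, S^{ψ₂}_{j+1} x̂) = ∑' t, 1{K_t = j} · 1{coin_{t+1}} · Λ(S^{ψ₁}_0 (θ_{t+1} x̂), S^{ψ₂}_0 (θ_{t+1} x̂))`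
— exactly one term if tour `j + 1` starts, none (and both sides vanish) if it never does. -/
theorem tourSum_eq_tsum_tourStart (ψ₁ ψ₂ : Ω × Bool → Ω × Bool → ℝ) (Λ : ℝ → ℝ → ℝ)
    (hΛ : Λ 0 0 = 0) (x : ℕ → Ω × Bool) (j : ℕ) :
    Λ (∑' u, (if (∑ s ∈ Finset.range u, (if (x (s + 1)).2 then (1 : ℕ) else 0)) = j + 1
          then (1 : ℝ) else 0) * ψ₁ (x u) (x (u + 1)))
      (∑' u, (if (∑ s ∈ Finset.range u, (if (x (s + 1)).2 then (1 : ℕ) else 0)) = j + 1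
          then (1 : ℝ) else 0) * ψ₂ (x u) (x (u + 1)))
      = ∑' t, (if (∑ s ∈ Finset.range t, (if (x (s + 1)).2 then (1 : ℕ) else 0)) = j
          then (1 : ℝ) else 0) * (if (x (t + 1)).2 then (1 : ℝ) else 0)
        * Λ (∑' n, (if (∑ s ∈ Finset.range n, (if (x (t + 1 + (s + 1))).2 then (1 : ℕ) else 0)) = 0
              then (1 : ℝ) else 0) * ψ₁ (x (t + 1 + n)) (x (t + 1 + (n + 1))))
            (∑' n, (if (∑ s ∈ Finset.range n, (if (x (t + 1 + (s + 1))).2 then (1 : ℕ) else 0)) = 0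
              then (1 : ℝ) else 0) * ψ₂ (x (t + 1 + n)) (x (t + 1 + (n + 1)))) := by
  by_cases hex : ∃ t, (∑ s ∈ Finset.range t, (if (x (s + 1)).2 then (1 : ℕ) else 0)) = j
      ∧ (x (t + 1)).2 = true
  · obtain ⟨t₀, ht₀, hh₀⟩ := hex
    symm
    rw [tsum_eq_single t₀]
    · rw [if_pos ht₀, if_pos hh₀, one_mul, one_mul, tourSum_transport ψ₁ x ht₀ hh₀,
        tourSum_transport ψ₂ x ht₀ hh₀]
    · intro t hne
      by_cases h1 : (∑ s ∈ Finset.range t, (if (x (s + 1)).2 then (1 : ℕ) else 0)) = j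
      · have h2 : ¬ (x (t + 1)).2 = true := fun h2 => hne (tourStart_unique x h1 h2 ht₀ hh₀)
        rw [if_neg h2, mul_zero, zero_mul]
      · rw [if_neg h1, zero_mul, zero_mul]
  · push Not at hex
    have hR : ∀ t, (if (∑ s ∈ Finset.range t, (if (x (s + 1)).2 then (1 : ℕ) else 0)) = j
        then (1 : ℝ) else 0) * (if (x (t + 1)).2 then (1 : ℝ) else 0) = 0 := fun t => by
      by_cases h1 : (∑ s ∈ Finset.range t, (if (x (s + 1)).2 then (1 : ℕ) else 0)) = j
      · rw [if_neg (hex t h1), mul_zero]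
      · rw [if_neg h1, zero_mul]
    have hL : ∀ (ψ : Ω × Bool → Ω × Bool → ℝ) (u : ℕ),
        (if (∑ s ∈ Finset.range u, (if (x (s + 1)).2 then (1 : ℕ) else 0)) = j + 1
          then (1 : ℝ) else 0) * ψ (x u) (x (u + 1)) = 0 := fun ψ u => by
      by_cases hu : (∑ s ∈ Finset.range u, (if (x (s + 1)).2 then (1 : ℕ) else 0)) = j + 1
      · exfalso
        have hs := sum_tourStart_indicator x j u
        rw [if_pos hu.symm.le, Finset.sum_eq_zero (fun t _ => hR t)] at hs
        exact zero_ne_one hs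
      · rw [if_neg hu, zero_mul]
    simp_rw [hL, tsum_zero, hΛ]
    symm
    exact (tsum_congr fun t => by rw [hR t, zero_mul]).trans tsum_zero

/-- The tour-start series `∑' t, 1{K_t = j} · 1{coin_{t+1}}` takes values in `[0, 1]` (at most one
term is nonzero). -/
theorem tourStart_tsum_mem (x : ℕ → Ω × Bool) (j : ℕ) :
    0 ≤ ∑' t, (if (∑ s ∈ Finset.range t, (if (x (s + 1)).2 then (1 : ℕ) else 0)) = j
        then (1 : ℝ) else 0) * (if (x (t + 1)).2 then (1 : ℝ) else 0)
      ∧ ∑' t, (if (∑ s ∈ Finset.range t, (if (x (s + 1)).2 then (1 : ℕ) else 0)) = j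
        then (1 : ℝ) else 0) * (if (x (t + 1)).2 then (1 : ℝ) else 0) ≤ 1 := by
  by_cases hex : ∃ t, (∑ s ∈ Finset.range t, (if (x (s + 1)).2 then (1 : ℕ) else 0)) = j
      ∧ (x (t + 1)).2 = true
  · obtain ⟨t₀, ht₀, hh₀⟩ := hex
    rw [tsum_eq_single t₀]
    · rw [if_pos ht₀, if_pos hh₀, mul_one]; exact ⟨zero_le_one, le_rfl⟩
    · intro t hne
      by_cases h1 : (∑ s ∈ Finset.range t, (if (x (s + 1)).2 then (1 : ℕ) else 0)) = j
      · have h2 : ¬ (x (t + 1)).2 = true := fun h2 => hne (tourStart_unique x h1 h2 ht₀ hh₀)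
        rw [if_neg h2, mul_zero]
      · rw [if_neg h1, zero_mul]
  · push Not at hex
    have hR : ∀ t, (if (∑ s ∈ Finset.range t, (if (x (s + 1)).2 then (1 : ℕ) else 0)) = j
        then (1 : ℝ) else 0) * (if (x (t + 1)).2 then (1 : ℝ) else 0) = 0 := fun t => by
      by_cases h1 : (∑ s ∈ Finset.range t, (if (x (s + 1)).2 then (1 : ℕ) else 0)) = j
      · rw [if_neg (hex t h1), mul_zero]
      · rw [if_neg h1, zero_mul]
    rw [(tsum_congr hR).trans tsum_zero]
    exact ⟨le_rfl, zero_le_one⟩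

end HeadCount

/-! ### Bookkeeping: integrability of series, measurability of tour functionals -/

section Bookkeeping

variable {S : Type*} [MeasurableSpace S]

/-- A series of integrable real functions with summable `L¹` norms is integrable (its integral is
then the sum of the integrals, Mathlib's `integral_tsum_of_summable_integral_norm`). -/
theorem integrable_tsum_of_summable_integral_norm (μ : Measure S) {F : ℕ → S → ℝ}
    (hF : ∀ i, Integrable (F i) μ) (hsum : Summable fun i => ∫ x, ‖F i x‖ ∂μ) :
    Integrable (fun x => ∑' i, F i x) μ := by
  have hBm : AEMeasurable (fun x => ∑' i, (‖F i x‖ₑ : ℝ≥0∞)) μ :=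
    AEMeasurable.tsum fun i => (hF i).1.enorm
  have hB : ∫⁻ x, ∑' i, (‖F i x‖ₑ : ℝ≥0∞) ∂μ ≠ ⊤ := by
    rw [lintegral_tsum fun i => (hF i).1.enorm]
    simp_rw [← ofReal_integral_norm_eq_lintegral_enorm (hF _)]
    rw [← ENNReal.ofReal_tsum_of_nonneg (fun i => integral_nonneg fun x => norm_nonneg _) hsum]
    exact ENNReal.ofReal_ne_top
  -- almost everywhere absolute summability
  have hae : ∀ᵐ x ∂μ, Summable fun i => ‖F i x‖ := by
    filter_upwards [ae_lt_top' hBm hB] with x hx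
    have h : Summable fun i => (‖F i x‖₊ : NNReal) :=
      ENNReal.tsum_coe_ne_top_iff_summable.1 (by simpa only [enorm] using hx.ne)
    simpa only [coe_nnnorm] using NNReal.summable_coe.2 h
  -- measurability of the sum: almost-everywhere limit of the partial sums
  have hmeas : AEStronglyMeasurable (fun x => ∑' i, F i x) μ := by
    refine aestronglyMeasurable_of_tendsto_ae (u := (atTop : Filter ℕ))
      (f := fun n x => ∑ i ∈ Finset.range n, F i x) (fun n => ?_) ?_
    · exact Finset.aestronglyMeasurable_fun_sum _ fun i _ => (hF i).1
    · filter_upwards [hae] with x hx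
      exact hx.of_norm.hasSum.tendsto_sum_nat
  -- domination by the envelope
  refine Integrable.mono' (integrable_toReal_of_lintegral_ne_top hBm hB) hmeas ?_
  filter_upwards [hae] with x hx
  calc ‖∑' i, F i x‖ ≤ ∑' i, ‖F i x‖ := norm_tsum_le_tsum_norm hx
    _ = (∑' i, (‖F i x‖ₑ : ℝ≥0∞)).toReal := by
        rw [ENNReal.tsum_toReal_eq fun i => enorm_ne_top]
        simp only [toReal_enorm]

variable {Ω : Type*} [MeasurableSpace Ω]

/-- The head count `K_t` is measurable, -/
theorem measurable_headCount (t : ℕ) : Measurable fun x : ℕ → Ω × Bool =>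
    ∑ s ∈ Finset.range t, (if (x (s + 1)).2 then (1 : ℕ) else 0) := by
  refine Finset.measurable_sum _ fun s _ => Measurable.ite ?_ measurable_const measurable_const
  exact (measurable_snd.comp (measurable_pi_apply _)) (measurableSet_singleton true)

/-- so is the tour indicator `1{K_t = i}`, -/
theorem measurable_headCountIndicator (t i : ℕ) : Measurable fun x : ℕ → Ω × Bool =>
    (if (∑ s ∈ Finset.range t, (if (x (s + 1)).2 then (1 : ℕ) else 0)) = i then (1 : ℝ) else 0) :=
  Measurable.ite ((measurable_headCount t) (measurableSet_singleton i)) measurable_const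
    measurable_const

/-- and the tour functional `S^ψ_i` for jointly measurable `ψ`. -/
theorem measurable_tourSum {ψ : Ω × Bool → Ω × Bool → ℝ}
    (hψ : Measurable fun pq : (Ω × Bool) × (Ω × Bool) => ψ pq.1 pq.2) (i : ℕ) :
    Measurable fun x : ℕ → Ω × Bool => ∑' u, (if (∑ s ∈ Finset.range u,
      (if (x (s + 1)).2 then (1 : ℕ) else 0)) = i then (1 : ℝ) else 0) * ψ (x u) (x (u + 1)) := by
  refine Measurable.tsum fun u => (measurable_headCountIndicator u i).mul ?_
  have hpair : Measurable fun x : ℕ → Ω × Bool => (x u, x (u + 1)) :=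
    (measurable_pi_apply u).prodMk (measurable_pi_apply (u + 1))
  exact hψ.comp hpair

end Bookkeeping


/-! ### Summability of the weighted tour-start probabilities -/

section TourStart

variable {Ω : Type*} [MeasurableSpace Ω]
  (κs : Kernel (Ω × Bool) (Ω × Bool)) [IsMarkovKernel κs]
  (μs : Measure (Ω × Bool)) [IsProbabilityMeasure μs]

/-- **The integrals of the weighted tour-start indicators are summable**: for `|G_t| ≤ C`,
`Σ_{t<n} E[|G_t| 1{K_t = j} 1{coin_{t+1}}] ≤ C` (the starts telescope), hence summable. -/
theorem summable_integral_tourStart (j : ℕ) {G : ℕ → (ℕ → Ω × Bool) → ℝ}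
    (hG : ∀ t, Measurable (G t)) {C : ℝ} (hC : ∀ t x, |G t x| ≤ C) :
    Summable fun t : ℕ => ∫ x, |G t x * (if (∑ s ∈ Finset.range t,
        (if (x (s + 1)).2 then (1 : ℕ) else 0)) = j then (1 : ℝ) else 0)|
        * (if (x (t + 1)).2 then (1 : ℝ) else 0)
      ∂(Kernel.trajMeasure (X := fun _ : ℕ => Ω × Bool) μs
        (fun n : ℕ => κs.comap (fun h : (i : ↥(Finset.Iic n)) → Ω × Bool =>
          h ⟨n, Finset.mem_Iic.2 le_rfl⟩) (measurable_pi_apply _))) := by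
  set P := Kernel.trajMeasure (X := fun _ : ℕ => Ω × Bool) μs
      (fun n : ℕ => κs.comap (fun h : (i : ↥(Finset.Iic n)) → Ω × Bool =>
        h ⟨n, Finset.mem_Iic.2 le_rfl⟩) (measurable_pi_apply _)) with hP
  have hC0 : 0 ≤ C :=
    (abs_nonneg _).trans (hC 0 fun _ => Classical.choice (nonempty_of_isProbabilityMeasure μs))
  have hint : ∀ t, Integrable (fun x : ℕ → Ω × Bool => |G t x * (if (∑ s ∈ Finset.range t,
      (if (x (s + 1)).2 then (1 : ℕ) else 0)) = j then (1 : ℝ) else 0)|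
      * (if (x (t + 1)).2 then (1 : ℝ) else 0)) P := fun t => by
    refine integrable_of_bounded P (((hG t).mul (measurable_headCountIndicator t j)).abs.mul
      (measurable_coinHeads (t + 1))) (C := C * 1 * 1) fun x => ?_
    rw [abs_mul, abs_abs, abs_mul]
    refine mul_le_mul (mul_le_mul (hC t x) ?_ (abs_nonneg _) hC0) ?_ (abs_nonneg _)
      (mul_nonneg hC0 zero_le_one) <;> split_ifs <;> simp
  refine summable_of_sum_range_le (c := C) (fun t => integral_nonneg fun x => ?_) fun n => ?_
  · exact mul_nonneg (abs_nonneg _) (by split_ifs <;> norm_num)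
  · rw [← integral_finsetSum _ fun t _ => hint t]
    have hpt : ∀ x : ℕ → Ω × Bool, ∑ t ∈ Finset.range n, |G t x * (if (∑ s ∈ Finset.range t,
        (if (x (s + 1)).2 then (1 : ℕ) else 0)) = j then (1 : ℝ) else 0)|
        * (if (x (t + 1)).2 then (1 : ℝ) else 0) ≤ C := fun x => by
      calc ∑ t ∈ Finset.range n, |G t x * (if (∑ s ∈ Finset.range t,
            (if (x (s + 1)).2 then (1 : ℕ) else 0)) = j then (1 : ℝ) else 0)|
            * (if (x (t + 1)).2 then (1 : ℝ) else 0)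
          ≤ ∑ t ∈ Finset.range n, C * ((if (∑ s ∈ Finset.range t,
            (if (x (s + 1)).2 then (1 : ℕ) else 0)) = j then (1 : ℝ) else 0)
            * (if (x (t + 1)).2 then (1 : ℝ) else 0)) := by
            refine Finset.sum_le_sum fun t _ => ?_
            rw [abs_mul, mul_assoc]
            refine mul_le_mul (hC t x) (le_of_eq ?_) ?_ hC0
            · congr 1; exact abs_of_nonneg (by split_ifs <;> norm_num)
            · exact mul_nonneg (abs_nonneg _) (by split_ifs <;> norm_num)
        _ = C * (if j + 1 ≤ ∑ s ∈ Finset.range n, (if (x (s + 1)).2 then (1 : ℕ) else 0)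
            then (1 : ℝ) else 0) := by rw [← Finset.mul_sum, sum_tourStart_indicator x j n]
        _ ≤ C := by split_ifs <;> nlinarith
    calc ∫ x, ∑ t ∈ Finset.range n, |G t x * (if (∑ s ∈ Finset.range t,
          (if (x (s + 1)).2 then (1 : ℕ) else 0)) = j then (1 : ℝ) else 0)|
          * (if (x (t + 1)).2 then (1 : ℝ) else 0) ∂P
        ≤ ∫ x, C ∂P := integral_mono (integrable_finsetSum _ fun t _ => hint t)
          (integrable_const C) hpt
      _ = C := by rw [integral_const, probReal_univ, one_smul]

end TourStart

end Summit.Ventures.LatticeQCDFlow.Scoring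

end
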